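import Mathlib
import Summits.Ventures.PercRepro2.Defs
import Summits.Ventures.PercRepro2.Graph
import Summits.Ventures.PercRepro2.OneColourSwitch
import Summits.Ventures.PercRepro2.RegionHubSign
import Summits.Ventures.PercRepro2.SideSwitch
import Summits.Ventures.PercRepro2.SideSwitchFibre
import Summits.Ventures.PercRepro2.SideSwitchComps
import Summits.Ventures.PercRepro2.M9NoPocketDefs
import Summits.Ventures.PercRepro2.M9NoPocketWorld
import Summits.Ventures.PercRepro2.M9NoPocketWorldD
import Summits.Ventures.PercRepro2.M9NoPocketCompl
import Summits.Ventures.PercRepro2.M9NoPocketCompl2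
import Summits.Ventures.PercRepro2.M9NoPocketFlipRS
import Summits.Ventures.PercRepro2.M9PsiOneDefs
import Summits.Ventures.PercRepro2.M9NoPocketFreeBlock
import Summits.Ventures.PercRepro2.M9NoPocketFreeBlockK
import Summits.Ventures.PercRepro2.M9QuadHarrisPow
import Summits.Ventures.PercRepro2.M9UnitAlgebra
import Summits.Ventures.PercRepro2.M9NoPocketSameType
import Summits.Ventures.PercRepro2.M9NoPocketDeadPattern
import Summits.Ventures.PercRepro2.M9NoPocketLinkCompl
import Summits.Ventures.PercRepro2.M9NoPocketLinkE
import Summits.Ventures.PercRepro2.M9NoPocketSigmaRS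

/-!
# The doubly-reached part of a unit (blind cell PercRepro2, p3 g36, 2026-08-29;
`proofs/P3-NPHDR.md` §5(d), in the unit form)

For a same-type representative `ρ₀` and its outside flip `ρ₁`, the doubly-reached points of
the two are the type-`E` points `(T ∪ S, ρ)` with `T` free, `∅ ≠ S ⊊ 𝔑` joined.  Their sign sum
is computed in three steps: the colour flip of a point is the dual point of the other
representative, so `σ_pq σ_rs` of a point is `y·σ_rs` at the point plus `y·σ_rs` at its dual
(`sigma_mul_eq_dual`, `y = [p ~_Y q]`), and the duals run again over all points
(`sum_EX_eq_G_add_G`, `sum_sdiff_sdiff_eq`); the sign `σ_rs` is the uniform formula of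
`M9NoPocketSigmaRS` for both representatives, with the sets and the link indicator of `ρ₀`
(`sigma_rs_E_eq_common`); and the algebra `sum_E_algebra` collects the result:
**`EX(ρ₀) + EX(ρ₁) = 2·Σ_{∅ ≠ S ⊊ 𝔑} (1 − ℓ S)·(HY S − HW (𝔑 ∖ S))`** (`EX_add_EX_eq`), with
`HY S = Σ_{T ∩ 𝔉L = ∅} (y₀ + y₁)(T ∪ S)`, `HW S = Σ_{𝔉L ⊆ T} (y₀ + y₁)(T ∪ S)` and
`ℓ S = [r ~_Y s with the joined `Y`-side set `S` and every free block switched]`.  Own work;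
std axioms.
-/

namespace Summit.Ventures.PercRepro2

namespace NoPocket

open Finset Classical RegionHub OneColourSwitch SideSwitch M9Reduce

variable {V : Type*} {E : Type*}

section Sets

variable [Fintype V] [DecidableEq V] [Fintype E] [DecidableEq E] {ends : E → Sym2 V}

omit [Fintype E] [DecidableEq E] in
/-- The free blocks of the outside flip. -/
lemma filter_free_flipOp {d r s : V} (hr : d ≠ r) (hs : d ≠ s) (ρ₀ : Config E) :
    (blocks ends d r s (flipOp ends d r s ρ₀)).filter
        (fun C => ¬ hasY ends d (flipOp ends d r s ρ₀) C) =
      (blocks ends d r s ρ₀).filter (fun C => ¬ hasY ends d ρ₀ C) := by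
  rw [blocks_flipOp hr hs]
  refine Finset.filter_congr (fun C hC => ?_)
  rw [hasY_flipOp hC]

omit [Fintype E] [DecidableEq E] in
/-- The joined blocks of the outside flip. -/
lemma filter_joined_flipOp {d r s : V} (hr : d ≠ r) (hs : d ≠ s) (ρ₀ : Config E) :
    (blocks ends d r s (flipOp ends d r s ρ₀)).filter (hasY ends d (flipOp ends d r s ρ₀)) =
      (blocks ends d r s ρ₀).filter (hasY ends d ρ₀) := by
  rw [blocks_flipOp hr hs]
  refine Finset.filter_congr (fun C hC => ?_)
  rw [hasY_flipOp hC]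

omit [Fintype E] [DecidableEq E] in
/-- The linking free blocks of the outside flip. -/
lemma filter_links_flipOp {d r s : V} (hr : d ≠ r) (hs : d ≠ s) (ρ₀ : Config E) :
    ((blocks ends d r s (flipOp ends d r s ρ₀)).filter
        (fun C => ¬ hasY ends d (flipOp ends d r s ρ₀) C)).filter
        (LinksIn ends (flipOp ends d r s ρ₀) r s) =
      ((blocks ends d r s ρ₀).filter (fun C => ¬ hasY ends d ρ₀ C)).filter
        (LinksIn ends ρ₀ r s) := by
  rw [filter_free_flipOp hr hs]
  refine Finset.filter_congr (fun C hC => ?_)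
  exact linksIn_flipOp_iff (Finset.mem_filter.1 hC).1

/-- The outside flip of a same-type representative is same-type. -/
lemma sameType_flipOp {p q r s d : V} (hnp : NoPocketAt ends d r s) (hr : d ≠ r) (hs : d ≠ s)
    (hT : Tset ends d r s = ∅) (hloop : ∀ e, ends e ≠ s(d, d)) {ρ₀ : Config E}
    (hρ₀ : ρ₀ ∈ RepD ends p q r s d) (hst : ∀ e, d ∈ ends e → ρ₀ e = true) :
    ∀ e, d ∈ ends e → flipOp ends d r s ρ₀ e = true :=
  (Finset.mem_filter.1 (flipOp_sameType hnp hr hs hT hloop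
    (Finset.mem_filter.2 ⟨hρ₀, hst⟩))).2

end Sets

section UnitE

variable [Fintype V] [DecidableEq V] [Fintype E] [DecidableEq E] {ends : E → Sym2 V}

/-- **The sign product at a point is `y·σ_rs` at the point plus `y·σ_rs` at its dual.** -/
lemma sigma_mul_eq_dual {p q r s d : V} (hnp : NoPocketAt ends d r s) (hr : d ≠ r) (hs : d ≠ s)
    (hT : Tset ends d r s = ∅) (hrs : ∀ e, ends e ≠ s(r, s)) {ρ : Config E}
    (hρ : ρ ∈ RepD ends p q r s d) {X : Finset (Finset V)} (hX : X ⊆ blocks ends d r s ρ) :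
    sigma ends (assignX ends (X, ∅) ρ) p q * sigma ends (assignX ends (X, ∅) ρ) r s =
      (if Conn ends (assignX ends (X, ∅) ρ) p q then 1 else 0) *
          sigma ends (assignX ends (X, ∅) ρ) r s +
        (if Conn ends (assignX ends (blocks ends d r s ρ \ X, ∅) (flipOp ends d r s ρ)) p q
          then 1 else 0) *
          sigma ends (assignX ends (blocks ends d r s ρ \ X, ∅) (flipOp ends d r s ρ)) r s := by
  have h1 := conn_compl_assignX_iff hnp hr hs hT hrs hρ hX p q
  have h2 := sigma_assignX_eq_neg_dual hnp hr hs hT hrs hρ hX r s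
  rw [h2]
  by_cases hc : Conn ends (assignX ends (X, ∅) ρ) p q <;>
    by_cases hc' : Conn ends (assignX ends (blocks ends d r s ρ \ X, ∅) (flipOp ends d r s ρ)) p q <;>
    simp only [sigma, h1, hc, hc', if_true, if_false] <;> ring

/-- **The doubly-reached sum of a representative splits into its `y·σ_rs` sum and that of its
outside flip** (the duals of the points are again all the points). -/
theorem sum_EX_eq_G_add_G {p q r s d : V} (hnp : NoPocketAt ends d r s) (hr : d ≠ r)
    (hs : d ≠ s) (hT : Tset ends d r s = ∅) (hrs : ∀ e, ends e ≠ s(r, s)) {ρ : Config E}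
    (hρ : ρ ∈ RepD ends p q r s d) {𝔉 𝔑 : Finset (Finset V)}
    (h𝔉 : 𝔉 = (blocks ends d r s ρ).filter (fun C => ¬ hasY ends d ρ C))
    (h𝔑 : 𝔑 = (blocks ends d r s ρ).filter (hasY ends d ρ)) :
    ∑ T ∈ 𝔉.powerset, ∑ S ∈ 𝔑.powerset.filter (fun S => S ≠ ∅ ∧ S ≠ 𝔑),
        sigma ends (assignX ends (T ∪ S, ∅) ρ) p q * sigma ends (assignX ends (T ∪ S, ∅) ρ) r s =
      (∑ T ∈ 𝔉.powerset, ∑ S ∈ 𝔑.powerset.filter (fun S => S ≠ ∅ ∧ S ≠ 𝔑),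
        (if Conn ends (assignX ends (T ∪ S, ∅) ρ) p q then 1 else 0) *
          sigma ends (assignX ends (T ∪ S, ∅) ρ) r s) +
      (∑ T ∈ 𝔉.powerset, ∑ S ∈ 𝔑.powerset.filter (fun S => S ≠ ∅ ∧ S ≠ 𝔑),
        (if Conn ends (assignX ends (T ∪ S, ∅) (flipOp ends d r s ρ)) p q then 1 else 0) *
          sigma ends (assignX ends (T ∪ S, ∅) (flipOp ends d r s ρ)) r s) := by
  have hstep : ∀ T ∈ 𝔉.powerset, ∀ S ∈ 𝔑.powerset.filter (fun S => S ≠ ∅ ∧ S ≠ 𝔑),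
      sigma ends (assignX ends (T ∪ S, ∅) ρ) p q * sigma ends (assignX ends (T ∪ S, ∅) ρ) r s =
        (if Conn ends (assignX ends (T ∪ S, ∅) ρ) p q then 1 else 0) *
          sigma ends (assignX ends (T ∪ S, ∅) ρ) r s +
        (if Conn ends (assignX ends ((𝔉 \ T) ∪ (𝔑 \ S), ∅) (flipOp ends d r s ρ)) p q
          then 1 else 0) *
          sigma ends (assignX ends ((𝔉 \ T) ∪ (𝔑 \ S), ∅) (flipOp ends d r s ρ)) r s := by
    intro T hTp S hS
    have hTf : T ⊆ (blocks ends d r s ρ).filter (fun C => ¬ hasY ends d ρ C) := by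
      rw [← h𝔉]; exact Finset.mem_powerset.1 hTp
    have hSj : S ⊆ (blocks ends d r s ρ).filter (hasY ends d ρ) := by
      rw [← h𝔑]; exact Finset.mem_powerset.1 (Finset.mem_filter.1 hS).1
    have hX : T ∪ S ⊆ blocks ends d r s ρ :=
      Finset.union_subset (hTf.trans (Finset.filter_subset _ _))
        (hSj.trans (Finset.filter_subset _ _))
    have hsd : blocks ends d r s ρ \ (T ∪ S) = (𝔉 \ T) ∪ (𝔑 \ S) := by
      rw [blocks_sdiff_union ρ hTf hSj, ← h𝔉, ← h𝔑]
    rw [sigma_mul_eq_dual hnp hr hs hT hrs hρ hX, hsd]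
  rw [Finset.sum_congr rfl (fun T hTp => Finset.sum_congr rfl (fun S hS => hstep T hTp S hS))]
  simp only [Finset.sum_add_distrib]
  have hb := sum_sdiff_sdiff_eq 𝔉 𝔑 (fun X =>
    (if Conn ends (assignX ends (X, ∅) (flipOp ends d r s ρ)) p q then 1 else 0) *
      sigma ends (assignX ends (X, ∅) (flipOp ends d r s ρ)) r s)
  rw [hb]

/-- **The sign `σ_rs` of a type-`E` point of either representative**, in the sets and the link
indicator of `ρ₀`. -/
theorem sigma_rs_E_eq_common {p q r s d : V} (hnp : NoPocketAt ends d r s) (hr : d ≠ r)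
    (hs : d ≠ s) (hT : Tset ends d r s = ∅) (hloop : ∀ e, ends e ≠ s(d, d))
    (hrs : ∀ e, ends e ≠ s(r, s)) {ρ₀ : Config E} (hρ₀ : ρ₀ ∈ RepD ends p q r s d)
    (hst : ∀ e, d ∈ ends e → ρ₀ e = true) {ρ : Config E}
    (hρ : ρ = ρ₀ ∨ ρ = flipOp ends d r s ρ₀) {T S : Finset (Finset V)}
    (hTf : T ⊆ (blocks ends d r s ρ₀).filter (fun C => ¬ hasY ends d ρ₀ C))
    (hS : S ⊆ (blocks ends d r s ρ₀).filter (hasY ends d ρ₀)) :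
    sigma ends (assignX ends (T ∪ S, ∅) ρ) r s =
      (if T ∩ ((blocks ends d r s ρ₀).filter (fun C => ¬ hasY ends d ρ₀ C)).filter
          (LinksIn ends ρ₀ r s) = ∅ then 1 else 0) *
        (1 - (if Conn ends (assignX ends ((blocks ends d r s ρ₀).filter
            (fun C => ¬ hasY ends d ρ₀ C) ∪ ((blocks ends d r s ρ₀).filter (hasY ends d ρ₀) \ S),
            ∅) ρ₀) r s then 1 else 0)) -
      (if ((blocks ends d r s ρ₀).filter (fun C => ¬ hasY ends d ρ₀ C)).filter
          (LinksIn ends ρ₀ r s) ⊆ T then 1 else 0) *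
        (1 - (if Conn ends (assignX ends ((blocks ends d r s ρ₀).filter
            (fun C => ¬ hasY ends d ρ₀ C) ∪ ((blocks ends d r s ρ₀).filter (hasY ends d ρ₀) \
              ((blocks ends d r s ρ₀).filter (hasY ends d ρ₀) \ S)), ∅) ρ₀) r s
          then 1 else 0)) := by
  simp only [Finset.sdiff_sdiff_eq_self hS]
  rcases hρ with rfl | rfl
  · exact sigma_rs_E_eq hnp hr hs hT hrs hρ₀ hst hTf hS
  · have hρ₁ := flipOp_mem_RepD hr hs hρ₀
    have hst₁ := sameType_flipOp hnp hr hs hT hloop hρ₀ hst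
    have hTf₁ : T ⊆ (blocks ends d r s (flipOp ends d r s ρ₀)).filter
        (fun C => ¬ hasY ends d (flipOp ends d r s ρ₀) C) := by
      rw [filter_free_flipOp hr hs]; exact hTf
    have hS₁ : S ⊆ (blocks ends d r s (flipOp ends d r s ρ₀)).filter
        (hasY ends d (flipOp ends d r s ρ₀)) := by
      rw [filter_joined_flipOp hr hs]; exact hS
    have h := sigma_rs_E_eq hnp hr hs hT hrs hρ₁ hst₁ hTf₁ hS₁
    rw [filter_links_flipOp hr hs, filter_free_flipOp hr hs, filter_joined_flipOp hr hs] at h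
    rw [h]
    have hL1 : ((blocks ends d r s ρ₀).filter (fun C => ¬ hasY ends d ρ₀ C) ∪
        ((blocks ends d r s ρ₀).filter (hasY ends d ρ₀) \ S), ∅) ∈ L4 ends d r s ρ₀ :=
      (mem_L4_sameType_iff hT hst).2 ⟨Finset.union_subset (Finset.filter_subset _ _)
        (Finset.sdiff_subset.trans (Finset.filter_subset _ _)), rfl⟩
    have hL2 : ((blocks ends d r s ρ₀).filter (fun C => ¬ hasY ends d ρ₀ C) ∪ S, ∅) ∈
        L4 ends d r s ρ₀ :=
      (mem_L4_sameType_iff hT hst).2 ⟨Finset.union_subset (Finset.filter_subset _ _)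
        (hS.trans (Finset.filter_subset _ _)), rfl⟩
    simp only [conn_rs_assignX_flipOp_iff hnp hr hs hρ₀ hL1,
      conn_rs_assignX_flipOp_iff hnp hr hs hρ₀ hL2]

/-- **The doubly-reached part of a unit.** -/
theorem EX_add_EX_eq {p q r s d : V} (hnp : NoPocketAt ends d r s) (hr : d ≠ r) (hs : d ≠ s)
    (hT : Tset ends d r s = ∅) (hloop : ∀ e, ends e ≠ s(d, d))
    (hrs : ∀ e, ends e ≠ s(r, s)) {ρ₀ : Config E} (hρ₀ : ρ₀ ∈ RepD ends p q r s d)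
    (hst : ∀ e, d ∈ ends e → ρ₀ e = true) {𝔉 𝔑 : Finset (Finset V)}
    (h𝔉 : 𝔉 = (blocks ends d r s ρ₀).filter (fun C => ¬ hasY ends d ρ₀ C))
    (h𝔑 : 𝔑 = (blocks ends d r s ρ₀).filter (hasY ends d ρ₀)) :
    (∑ T ∈ 𝔉.powerset, ∑ S ∈ 𝔑.powerset.filter (fun S => S ≠ ∅ ∧ S ≠ 𝔑),
        sigma ends (assignX ends (T ∪ S, ∅) ρ₀) p q *
          sigma ends (assignX ends (T ∪ S, ∅) ρ₀) r s) +
      (∑ T ∈ 𝔉.powerset, ∑ S ∈ 𝔑.powerset.filter (fun S => S ≠ ∅ ∧ S ≠ 𝔑),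
        sigma ends (assignX ends (T ∪ S, ∅) (flipOp ends d r s ρ₀)) p q *
          sigma ends (assignX ends (T ∪ S, ∅) (flipOp ends d r s ρ₀)) r s) =
      2 * ∑ S ∈ 𝔑.powerset.filter (fun S => S ≠ ∅ ∧ S ≠ 𝔑),
        (1 - (if Conn ends (assignX ends (𝔉 ∪ (𝔑 \ S), ∅) ρ₀) r s then 1 else 0)) *
        ((∑ T ∈ 𝔉.powerset.filter (fun T => T ∩ (𝔉.filter (LinksIn ends ρ₀ r s)) = ∅),
            ((if Conn ends (assignX ends (T ∪ S, ∅) ρ₀) p q then 1 else 0) +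
              (if Conn ends (assignX ends (T ∪ S, ∅) (flipOp ends d r s ρ₀)) p q
                then 1 else 0))) -
          (∑ T ∈ 𝔉.powerset.filter (fun T => 𝔉.filter (LinksIn ends ρ₀ r s) ⊆ T),
            ((if Conn ends (assignX ends (T ∪ (𝔑 \ S), ∅) ρ₀) p q then 1 else 0) +
              (if Conn ends (assignX ends (T ∪ (𝔑 \ S), ∅) (flipOp ends d r s ρ₀)) p q
                then 1 else 0)))) := by
  have hρ₁ := flipOp_mem_RepD hr hs hρ₀
  -- the two doubly-reached sums split into `y·σ_rs` sums
  have e0 := sum_EX_eq_G_add_G hnp hr hs hT hrs hρ₀ h𝔉 h𝔑 (p := p) (q := q)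
  have h𝔉₁ : 𝔉 = (blocks ends d r s (flipOp ends d r s ρ₀)).filter
      (fun C => ¬ hasY ends d (flipOp ends d r s ρ₀) C) := by
    rw [filter_free_flipOp hr hs]; exact h𝔉
  have h𝔑₁ : 𝔑 = (blocks ends d r s (flipOp ends d r s ρ₀)).filter
      (hasY ends d (flipOp ends d r s ρ₀)) := by
    rw [filter_joined_flipOp hr hs]; exact h𝔑
  have e1 := sum_EX_eq_G_add_G hnp hr hs hT hrs hρ₁ h𝔉₁ h𝔑₁ (p := p) (q := q)
  rw [flipOp_flipOp hr hs] at e1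
  rw [e0, e1]
  -- the common sign formula
  have hσ : ∀ T ∈ 𝔉.powerset, ∀ S ∈ 𝔑.powerset.filter (fun S => S ≠ ∅ ∧ S ≠ 𝔑),
      (if Conn ends (assignX ends (T ∪ S, ∅) ρ₀) p q then 1 else 0) *
          sigma ends (assignX ends (T ∪ S, ∅) ρ₀) r s +
        (if Conn ends (assignX ends (T ∪ S, ∅) (flipOp ends d r s ρ₀)) p q then 1 else 0) *
          sigma ends (assignX ends (T ∪ S, ∅) (flipOp ends d r s ρ₀)) r s =
      ((if Conn ends (assignX ends (T ∪ S, ∅) ρ₀) p q then 1 else 0) +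
        (if Conn ends (assignX ends (T ∪ S, ∅) (flipOp ends d r s ρ₀)) p q then 1 else 0)) *
        ((if T ∩ (𝔉.filter (LinksIn ends ρ₀ r s)) = ∅ then 1 else 0) *
          (1 - (if Conn ends (assignX ends (𝔉 ∪ (𝔑 \ S), ∅) ρ₀) r s then 1 else 0)) -
        (if 𝔉.filter (LinksIn ends ρ₀ r s) ⊆ T then 1 else 0) *
          (1 - (if Conn ends (assignX ends (𝔉 ∪ (𝔑 \ (𝔑 \ S)), ∅) ρ₀) r s
            then 1 else 0))) := by
    intro T hTp S hS
    have hTf : T ⊆ (blocks ends d r s ρ₀).filter (fun C => ¬ hasY ends d ρ₀ C) := by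
      rw [← h𝔉]; exact Finset.mem_powerset.1 hTp
    have hSj : S ⊆ (blocks ends d r s ρ₀).filter (hasY ends d ρ₀) := by
      rw [← h𝔑]; exact Finset.mem_powerset.1 (Finset.mem_filter.1 hS).1
    have c0 := sigma_rs_E_eq_common hnp hr hs hT hloop hrs hρ₀ hst (Or.inl rfl) hTf hSj
    have c1 := sigma_rs_E_eq_common hnp hr hs hT hloop hrs hρ₀ hst (Or.inr rfl) hTf hSj
    rw [← h𝔉, ← h𝔑] at c0 c1
    rw [c0, c1]
    ring
  have hsum : (∑ T ∈ 𝔉.powerset, ∑ S ∈ 𝔑.powerset.filter (fun S => S ≠ ∅ ∧ S ≠ 𝔑),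
        (if Conn ends (assignX ends (T ∪ S, ∅) ρ₀) p q then 1 else 0) *
          sigma ends (assignX ends (T ∪ S, ∅) ρ₀) r s) +
      (∑ T ∈ 𝔉.powerset, ∑ S ∈ 𝔑.powerset.filter (fun S => S ≠ ∅ ∧ S ≠ 𝔑),
        (if Conn ends (assignX ends (T ∪ S, ∅) (flipOp ends d r s ρ₀)) p q then 1 else 0) *
          sigma ends (assignX ends (T ∪ S, ∅) (flipOp ends d r s ρ₀)) r s) =
      ∑ T ∈ 𝔉.powerset, ∑ S ∈ 𝔑.powerset.filter (fun S => S ≠ ∅ ∧ S ≠ 𝔑),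
        ((if Conn ends (assignX ends (T ∪ S, ∅) ρ₀) p q then 1 else 0) +
          (if Conn ends (assignX ends (T ∪ S, ∅) (flipOp ends d r s ρ₀)) p q then 1 else 0)) *
        ((if T ∩ (𝔉.filter (LinksIn ends ρ₀ r s)) = ∅ then 1 else 0) *
          (1 - (if Conn ends (assignX ends (𝔉 ∪ (𝔑 \ S), ∅) ρ₀) r s then 1 else 0)) -
        (if 𝔉.filter (LinksIn ends ρ₀ r s) ⊆ T then 1 else 0) *
          (1 - (if Conn ends (assignX ends (𝔉 ∪ (𝔑 \ (𝔑 \ S)), ∅) ρ₀) r s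
            then 1 else 0))) := by
    rw [← Finset.sum_add_distrib]
    refine Finset.sum_congr rfl (fun T hTp => ?_)
    rw [← Finset.sum_add_distrib]
    exact Finset.sum_congr rfl (fun S hS => hσ T hTp S hS)
  have key := sum_E_algebra 𝔉 (𝔉.filter (LinksIn ends ρ₀ r s)) 𝔑
    (fun X => (if Conn ends (assignX ends (X, ∅) ρ₀) p q then 1 else 0) +
      (if Conn ends (assignX ends (X, ∅) (flipOp ends d r s ρ₀)) p q then 1 else 0))
    (fun S => if Conn ends (assignX ends (𝔉 ∪ (𝔑 \ S), ∅) ρ₀) r s then 1 else 0)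
  linear_combination (2 : ℤ) * hsum + (2 : ℤ) * key

end UnitE

end NoPocket

end Summit.Ventures.PercRepro2
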